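import Mathlib.LinearAlgebra.Matrix.Trace
import Mathlib.Data.Real.Basic
import Mathlib.Data.Matrix.Basic

/-!
# Stub `stub_weylTracefreeRiccati` of line `Sketch` for crux `YamabePinchedEinsteinBulk`
(item stmt-SmoothPoincare4-7996, routes `InformationMetricHadamard` / `EinsteinBulk`)

**Trace-free Riccati extraction of the radial Weyl operator.** Along a geodesic ray of a
Poincaré–Einstein `5`-manifold, in a parallel frame of `γ'^⊥ ≅ ℝ⁴`, the shape operator `𝒰` of the
distance spheres solves the Einstein Riccati equation `𝒰' = 1 − 𝒲 − 𝒰²` with `𝒲` (the radial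
Weyl operator) trace-free. This file proves the pure polynomial identity in `4 × 4` real matrices
extracting `𝒲` from the trace-free parts:
`𝒲 = −(𝒰' − (tr 𝒰'/4) I) − (H/2) 𝒰° − ((𝒰°)² − (tr (𝒰°)²/4) I)`, where `H = tr 𝒰` and
`𝒰° = 𝒰 − (H/4) I`.

Proof: substitute `𝒰' = 1 − 𝒲 − 𝒰²`; `tr I = 4` and `tr 𝒲 = 0` give `tr 𝒰' = 4 − tr 𝒰²`;
expand `(𝒰 − (H/4) I)² = 𝒰² − (H/2) 𝒰 + (H²/16) I` (`𝒰` commutes with `I`), whose trace is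
`tr 𝒰² − H²/4`; after that every term cancels entrywise (the entries of `𝒰²` are kept atomic).
Mathlib only; no `sorry`.
-/

noncomputable section

-- the prescribed namespace `Summit.<P>.<Sub>.…` duplicates `SmoothPoincare4` (P = Sub)
set_option linter.dupNamespace false

namespace Summit.SmoothPoincare4.SmoothPoincare4.Cruxes.YamabePinchedEinsteinBulk.Sketch

/-- **Trace-free Riccati extraction of the radial Weyl operator.** If `𝒰' = 1 − 𝒲 − 𝒰²` and
`tr 𝒲 = 0` then `𝒲 = −(𝒰' − (tr 𝒰'/4) I) − (tr 𝒰/2) 𝒰° − ((𝒰°)² − (tr (𝒰°)²/4) I)`,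
`𝒰° = 𝒰 − (tr 𝒰/4) I` (a polynomial identity in `4 × 4` matrices). [folklore] -/
theorem stub_weylTracefreeRiccati :
    ∀ (U U' W : Matrix (Fin 4) (Fin 4) ℝ), U' = -(-1 + W) - U * U → W.trace = 0 →
      W = -(U' - (U'.trace / 4) • (1 : Matrix (Fin 4) (Fin 4) ℝ))
            - (U.trace / 2) • (U - (U.trace / 4) • (1 : Matrix (Fin 4) (Fin 4) ℝ))
            - ((U - (U.trace / 4) • (1 : Matrix (Fin 4) (Fin 4) ℝ)) *
                  (U - (U.trace / 4) • (1 : Matrix (Fin 4) (Fin 4) ℝ))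
                - ((((U - (U.trace / 4) • (1 : Matrix (Fin 4) (Fin 4) ℝ)) *
                      (U - (U.trace / 4) • (1 : Matrix (Fin 4) (Fin 4) ℝ))).trace / 4) •
                    (1 : Matrix (Fin 4) (Fin 4) ℝ))) := by
  intro U U' W hU' hW
  subst hU'
  -- `tr I = 4` on `Fin 4`
  have h1 : (1 : Matrix (Fin 4) (Fin 4) ℝ).trace = 4 := by
    rw [Matrix.trace_one, Fintype.card_fin]; norm_num
  -- `tr 𝒰' = 4 − tr 𝒰²`
  have htr : (-(-1 + W) - U * U).trace = 4 - (U * U).trace := by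
    simp only [Matrix.trace_sub, Matrix.trace_neg, Matrix.trace_add, h1, hW]; ring
  -- `(𝒰 − (H/4) I)² = 𝒰² − (H/2) 𝒰 + (H²/16) I`
  have hexp : (U - (U.trace / 4) • (1 : Matrix (Fin 4) (Fin 4) ℝ)) *
      (U - (U.trace / 4) • (1 : Matrix (Fin 4) (Fin 4) ℝ)) =
        U * U - (U.trace / 2) • U + (U.trace ^ 2 / 16) • (1 : Matrix (Fin 4) (Fin 4) ℝ) := by
    rw [sub_mul, mul_sub, mul_sub, Matrix.mul_smul, Matrix.mul_one, Matrix.smul_mul,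
      Matrix.one_mul, Matrix.smul_mul, Matrix.one_mul, smul_smul]
    ext i j
    simp only [Matrix.sub_apply, Matrix.add_apply, Matrix.smul_apply, smul_eq_mul]
    ring
  -- its trace is `tr 𝒰² − H²/4`
  have htr2 : ((U - (U.trace / 4) • (1 : Matrix (Fin 4) (Fin 4) ℝ)) *
      (U - (U.trace / 4) • (1 : Matrix (Fin 4) (Fin 4) ℝ))).trace =
        (U * U).trace - U.trace ^ 2 / 4 := by
    rw [hexp, Matrix.trace_add, Matrix.trace_sub, Matrix.trace_smul, Matrix.trace_smul, h1,
      smul_eq_mul, smul_eq_mul]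
    ring
  rw [htr2, htr, hexp]
  -- everything cancels entrywise, the entries of `𝒰²` being kept atomic
  ext i j
  simp only [Matrix.sub_apply, Matrix.add_apply, Matrix.neg_apply, Matrix.smul_apply,
    Matrix.one_apply, smul_eq_mul]
  split_ifs <;> ring

end Summit.SmoothPoincare4.SmoothPoincare4.Cruxes.YamabePinchedEinsteinBulk.Sketch

end
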